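import Summits.NavierStokesRegularity.FluidComputer.PalasekTowerGermHostShadowedRun
import Summits.NavierStokesRegularity.FluidComputer.PalasekTowerFaceLacunarityLaws
import Literature.Analysis.FluidPDE.OseenSliceConstLowerBound

/-!
# The germ host, SHADOWED-RUN DOOR: the price as an UNCONDITIONAL NUMBER
# (`C₀ ≥ (4π)^{-1/2}` ⇒ total defect `≤ ¼ e^{-15700}`)

Cell `ns-blowup`, seat `ns-blowup-fc-prover-3` (g9; D-0074 GROUP C «BRIDGE SUPPORT»; bears_on LADDER-NS N1,
route `PalasekTowerBreakdown`, crux `EpisodeBase` = item stmt-NavierStokesRegularity-19179, line `slot` v5).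
LABEL: E–C typing + kernel arithmetic (theorems only; no definition, no named fact, no `sorry`).
WHAT THIS IS NOT: not Navier–Stokes evidence — arithmetic on the hypothesis of a door; no run, approximate
run or certificate is exhibited; no verdict on the crux (the free run itself may exist — only its
CERTIFICATION through sup-norm shadowing is priced).

`PalasekTowerGermHostShadowedRun.lean` §3 (p511595) priced the certificate door of the crux modulo the
Oseen slice constant: a reference meeting the speed face has `Y₁ ≤ M`, hence `(M+(M+1))² w₀ > 5508` and the
door's smallness hypothesis forces `2 (D + F) e^{36·5508·C₀²} ≤ 1/2` (`Germ.defect_le_of_door_hypothesis`),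
`C₀ = oseenSliceConst ℝ³` a `Classical.choose` constant. The Literature file `OseenSliceConstLowerBound`
(this seat; refuter4 g8 K167 (R1)) evaluates the shear layer on the closed Koch–Tataru kernel and proves
`(4π)^{-1/2} ≤ C₀`, `0.282 < C₀`. Hence:

* `Germ.shadowing_rate_gt` — `15700 < 36 · C₀² · 5508`;
* **`Germ.defect_le_exp_neg_of_door_hypothesis`** — under the door's smallness hypothesis with `Y₁ ≤ M`
  and `δ ≤ 1/2`, the certificate's total defect satisfies `D + F ≤ ¼ · e^{−15700}` (and
  `2 (D + F) e^{15700} ≤ 1/2`): NO floating-point or multiprecision residual passes the sup-norm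
  shadowing door across window `0` of the register — the door is CLOSED in practice, unconditionally.
  What remains for a certificate of the base episode: an exact run (`D = F = 0`, the free-run door
  p498061), an a-posteriori theory in energy currency (fee `e^{∫‖∇w‖_∞}`, between `e^{61.7}` and
  `≈ e^{221}` at the register's strain floors — untyped on `ℝ³`), or a Newton–Kantorovich enclosure
  (untyped) — each pluggable into the currency-free letter `LineGermData.exists_sliceRun_of_near_freeRun`
  (p514213).
* §2 RE-TUNING (arbitrary rates record `R`, EVERY window `k`; register arithmetic only — the door is typed
  for `wide`, window `0`): `TowerRates.eight_mul_log_lt_window_mul_Y_sq` (`8 log N_k < w_k Y_k² =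
  4b²β log N_k · N_k^{β−2}`), `TowerRates.cap_factor_window_gt` (`(800/9) log N_k < ((5/3)Y_{k+1} +
  ((5/3)Y_{k+1} + 1))² w_k`), `TowerRates.leray_exponent_window_gt` (`254 · log N_k < 36 C₀² · (cap factor)`)
  and their level-`0` forms: the register factor of Leray's sup-norm stability exponent at the cap of ANY
  window exceeds `254 log N_k` for EVERY admissible Palasek register — re-tuning `(N₀, b, β)` cannot bring
  a sup-norm shadowing door below `N_k^{254}` (all slack dropped; the wide register's honest number at
  window `0` is `e^{15700}`).

References: G. Koch, N. Nadirashvili, G. Seregin, V. Šverák, Acta Math. 203 (2009) §3 (3.5)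
[cite: KochNadirashviliSereginSverak2009, §3 (3.5) and §4 p. 8 (arXiv:0709.3599v1)]; S. Palasek,
arXiv:2605.13827 §4 [cite: Palasek2026ElementaryModel, §4]; M. Dashti, J. C. Robinson, SIAM J. Numer.
Anal. 46 (2008) [cite: DashtiRobinson2008, Thm. 5].
-/

noncomputable section

namespace Summit.NavierStokesRegularity.FluidComputer.PalasekTowerClayBridge.Germ

open Set Real
open Literature.Analysis Literature.Analysis.FluidPDE

/-- **The rate of the door, in numbers**: `36 · C₀² · 5508 > 15700` (`C₀ > 0.282`, `0.282² · 198288 = 15768.6…`).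
[cite: KochNadirashviliSereginSverak2009, §3 (3.5) and §4 p. 8 (arXiv:0709.3599v1)] -/
theorem shadowing_rate_gt :
    (15700 : ℝ) < 36 * oseenSliceConst (EuclideanSpace ℝ (Fin 3)) ^ 2 * 5508 := by
  have h := oseenSliceConst_gt
  have h0 : (0 : ℝ) < 0.282 := by norm_num
  have h2 : (0.282 : ℝ) ^ 2 < oseenSliceConst (EuclideanSpace ℝ (Fin 3)) ^ 2 :=
    pow_lt_pow_left₀ h h0.le two_ne_zero
  nlinarith

/-- **THE PRICE, UNCONDITIONAL.** If a reference field with `Y₁ ≤ M` (any reference meeting the speed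
face of the letter) satisfies the smallness hypothesis of the shadowed-run door
`2 (D + F) exp (36 C₀² (M+(M+1))² w₀) ≤ δ` with `δ ≤ 1/2` and `D + F ≥ 0`, then
`2 (D + F) · e^{15700} ≤ 1/2`, i.e. the certificate's total defect is `D + F ≤ ¼ e^{−15700}`.
[cite: Palasek2026ElementaryModel, §4] [cite: DashtiRobinson2008, Thm. 5] -/
theorem defect_le_exp_neg_of_door_hypothesis {M D F δ : ℝ} (hM : TowerRates.wide.Y 1 ≤ M)
    (hDF : 0 ≤ D + F)
    (hδ : 2 * (D + F) *
      Real.exp (36 * oseenSliceConst (EuclideanSpace ℝ (Fin 3)) ^ 2 * (M + (M + 1)) ^ 2 / 1 * Host.wfirst) ≤ δ)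
    (hδ2 : δ ≤ 1 / 2) :
    2 * (D + F) * Real.exp 15700 ≤ 1 / 2 ∧ D + F ≤ 1 / 4 * Real.exp (-15700) := by
  have h1 := defect_le_of_door_hypothesis hM hDF hδ hδ2
  have hexp : Real.exp 15700 ≤ Real.exp (36 * oseenSliceConst (EuclideanSpace ℝ (Fin 3)) ^ 2 * 5508) :=
    Real.exp_le_exp.2 shadowing_rate_gt.le
  have h2 : 2 * (D + F) * Real.exp 15700 ≤ 1 / 2 :=
    (mul_le_mul_of_nonneg_left hexp (by positivity)).trans h1
  refine ⟨h2, ?_⟩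
  have hpos : 0 < Real.exp 15700 := Real.exp_pos _
  have hinv : Real.exp (-15700) = (Real.exp 15700)⁻¹ := Real.exp_neg _
  rw [hinv, ← div_eq_mul_inv, le_div_iff₀ hpos]
  linarith

end Summit.NavierStokesRegularity.FluidComputer.PalasekTowerClayBridge.Germ

/-! ## §2 Re-tuning: the register factor for an arbitrary rates record and EVERY window -/

namespace Summit.NavierStokesRegularity.FluidComputer.PalasekTowerClayBridge.TowerRates

open Real
open Literature.Analysis Literature.Analysis.FluidPDE

variable (R : TowerRates)

/-- **`8 log N_k < w_k Y_k²`** for every admissible rates record and every level: the window law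
`w_k Y_k² = 4b²β · log N_k · N_k^{β−2}` with `b > 1`, `β > 2`, `N_k > 1`. [cite: Palasek2026ElementaryModel, §3.3] -/
theorem eight_mul_log_lt_window_mul_Y_sq (k : ℕ) : 8 * Real.log (R.N k) < R.window k * R.Y k ^ 2 := by
  rw [R.window_mul_Y_sq k]
  have hb := R.one_lt_b
  have hβ := R.two_lt_β
  have hN := R.one_lt_N k
  have hlog : 0 < Real.log (R.N k) := Real.log_pos hN
  have hpow : 1 ≤ R.N k ^ (R.β - 2) := Real.one_le_rpow hN.le (by linarith)
  have hb2 : 1 < R.b ^ 2 := by nlinarith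
  have hbβ : (1 : ℝ) * 2 < R.b ^ 2 * R.β := mul_lt_mul'' hb2 hβ zero_le_one zero_le_two
  have h1 : 8 * Real.log (R.N k) < 4 * R.b ^ 2 * R.β * Real.log (R.N k) := by
    have := mul_lt_mul_of_pos_right hbβ hlog
    linarith
  have h2 : 0 ≤ 4 * R.b ^ 2 * R.β * Real.log (R.N k) := by positivity
  calc 8 * Real.log (R.N k) < 4 * R.b ^ 2 * R.β * Real.log (R.N k) * 1 := by rw [mul_one]; exact h1
    _ ≤ 4 * R.b ^ 2 * R.β * Real.log (R.N k) * R.N k ^ (R.β - 2) := mul_le_mul_of_nonneg_left hpow h2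

/-- Level `0`: **`8 log N₀ < w₀ Y₀²`**. [cite: Palasek2026ElementaryModel, §3.3] -/
theorem eight_mul_log_lt_window_zero_mul_Y_zero_sq : 8 * Real.log R.N₀ < R.window 0 * R.Y 0 ^ 2 := by
  have h := R.eight_mul_log_lt_window_mul_Y_sq 0
  rwa [R.N_zero_eq_N₀] at h

/-- **The cap factor of window `k` exceeds `(800/9) log N_k`** for every admissible rates record and every
level: `((5/3)Y_{k+1} + ((5/3)Y_{k+1} + 1))² w_k ≥ (100/9) Y_k² w_k > (800/9) log N_k` (`Y_k < Y_{k+1}`).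
[cite: Palasek2026ElementaryModel, §3.3] -/
theorem cap_factor_window_gt (k : ℕ) :
    800 / 9 * Real.log (R.N k) < (5 / 3 * R.Y (k + 1) + (5 / 3 * R.Y (k + 1) + 1)) ^ 2 * R.window k := by
  have h := R.eight_mul_log_lt_window_mul_Y_sq k
  have hY01 : R.Y k < R.Y (k + 1) := R.Y_lt_Y_succ k
  have hY0 : 0 < R.Y k := Real.rpow_pos_of_pos (R.N_pos k) _
  have hw : 0 < R.window k := R.window_pos k
  have h1 : 100 / 9 * R.Y k ^ 2 ≤ (5 / 3 * R.Y (k + 1) + (5 / 3 * R.Y (k + 1) + 1)) ^ 2 := by nlinarith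
  have h2 : 100 / 9 * (R.window k * R.Y k ^ 2) ≤
      (5 / 3 * R.Y (k + 1) + (5 / 3 * R.Y (k + 1) + 1)) ^ 2 * R.window k := by
    have := mul_le_mul_of_nonneg_right h1 hw.le
    linarith
  linarith

/-- Level `0`: **`(800/9) log N₀ < ((5/3)Y₁ + ((5/3)Y₁ + 1))² w₀`**. [cite: Palasek2026ElementaryModel, §3.3] -/
theorem cap_factor_window_zero_gt :
    800 / 9 * Real.log R.N₀ < (5 / 3 * R.Y 1 + (5 / 3 * R.Y 1 + 1)) ^ 2 * R.window 0 := by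
  have h := R.cap_factor_window_gt 0
  rwa [R.N_zero_eq_N₀] at h

/-- **Leray's sup-norm exponent at the cap of window `k` exceeds `254 · log N_k` for EVERY admissible
register and EVERY level** (`C₀ > 0.282`, `36 · 0.282² · 800/9 = 254.4…`): re-tuning `(N₀, b, β)` cannot
bring the register factor of a sup-norm shadowing door across any window below `N_k^{254}` (all slack
dropped). Register arithmetic; the door itself is typed for the wide record's window `0` only.
[cite: Palasek2026ElementaryModel, §3.3]
[cite: KochNadirashviliSereginSverak2009, §3 (3.5) and §4 p. 8 (arXiv:0709.3599v1)] -/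
theorem leray_exponent_window_gt (k : ℕ) :
    254 * Real.log (R.N k) <
      36 * oseenSliceConst (EuclideanSpace ℝ (Fin 3)) ^ 2 *
        ((5 / 3 * R.Y (k + 1) + (5 / 3 * R.Y (k + 1) + 1)) ^ 2 * R.window k) := by
  have h := R.cap_factor_window_gt k
  have hlog : 0 < Real.log (R.N k) := Real.log_pos (R.one_lt_N k)
  have hC := oseenSliceConst_gt
  have h0 : (0 : ℝ) < 0.282 := by norm_num
  have hC2 : (0.282 : ℝ) ^ 2 < oseenSliceConst (EuclideanSpace ℝ (Fin 3)) ^ 2 :=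
    pow_lt_pow_left₀ hC h0.le two_ne_zero
  nlinarith

/-- Level `0`: **`254 · log N₀ < 36 C₀² · ((5/3)Y₁ + ((5/3)Y₁+1))² w₀`** for every admissible register.
[cite: Palasek2026ElementaryModel, §3.3] -/
theorem leray_exponent_window_zero_gt :
    254 * Real.log R.N₀ <
      36 * oseenSliceConst (EuclideanSpace ℝ (Fin 3)) ^ 2 *
        ((5 / 3 * R.Y 1 + (5 / 3 * R.Y 1 + 1)) ^ 2 * R.window 0) := by
  have h := R.leray_exponent_window_gt 0
  rwa [R.N_zero_eq_N₀] at h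

end Summit.NavierStokesRegularity.FluidComputer.PalasekTowerClayBridge.TowerRates

end
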